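import Summits.BirchSwinnertonDyer.BirchSwinnertonDyer.Theorems.ClassRecordThreeEulerHalvesAtThreeOfExceptionalZeroRoad

/-!
# Route `ClassRecordThree` (rung K2@3): the rung LEAF `X11b.MultiplicativeRankOneAtThree` from the
# route's cruxes WITH crux 5 `EulerHalvesAtThree` (item 19109) AND the Shimura-curve package of the
# pure-β sub-atom REPLACED by the exceptional-zero road's two inputs — the exceptional display on the
# split locus and rung I1 at `3` (cell `bsd-stepL`, seat `bsd-stepL-mult-p4` g3;
# `--supports stmt-BirchSwinnertonDyer-19109`)

Cell `bsd-stepL` (D-0131 (3) middle tier, seat `bsd-stepL-mult-p4`, lens «split-multiplicative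
`r = 1` via the 𝓛-invariant `p`-adic Gross–Zagier + Kobayashi 2006»). THEOREMS ONLY, CONDITIONAL on
the PUBLISHED named facts in the binders and on the typed inputs named below; no definition, no new
fact, no `sorry`; nothing about any curve is asserted and no census word moves (TARGET T7).

## What

The route's deciding theorem `Theses.ClassRecordThree.closes` (rev 29) reaches the rung-K2 leaf
`X11b.MultiplicativeRankOneAtThree` (`BSD(E,3)` for every `E/ℚ` with `r_an = 1`, `3 ∥ N`, `E[3]`
irreducible) through the kernel class record
`Theorems.multiplicativeRankOneAtThree_of_classRecord_upperB`, whose four Euler-system binders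
`hUβ` (pure-(T2β) split (ram) pairs), `hUα`, `hUγ` ((T2α), (T2γ∖α) — crux 5 `EulerHalvesAtThree`
clauses (1)–(2)) and `hU₀` (¬(ram) ∧ surj — clause (3)) all ask for the SAME typed statement
`Typed.MissingUpperBoundAt W 3`. The exceptional-zero road supplies that statement on EVERY X11b@3
pair with `ρ̄_{E,3}` onto, SHAPE-FREE and TAMAGAWA-BLIND (gen 2, p545447:
`Three.missingUpperBoundAt_of_surj_split_of_conjecture_of_schneiderSplit` — Kato's divisibility in
Wuthrich's surjective shape, the `3`-adic tower being onto by `surjective_pow_of_mult_of_surj`, read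
through Jones ∕ Stein–Wuthrich Thm. 6.1 and the exceptional display; and
`Three.missingUpperBoundAt_of_surj_nonsplit_of_schneiderNonsplit` — the same with Disegni 2020 Thm. 1's
NON-split clause, PUBLISHED at every odd `p`). Hence:

**the leaf follows from the route's cruxes `SchneiderAtThree` (19106), `HalvesAtThreeR` (20194),
`HsiehDescentAtThree`, `CornerAtThree` (19111) and the support `PublishedInputsThree` (19112) — WITHOUT
crux 5 `EulerHalvesAtThree` (19109: Jetchev's Tamagawa divisibility on multi-carrier frames, the X11a
lower half of the twist) and WITHOUT the Shimura-curve inputs of the pure-β sub-atom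
(`ShimuraParametrizationDataNonempty`, `PastenRibetTakahashiPackage`, `ShimuraCurveFactOffLocusThree`,
`ShimuraCasselsTateLevelInputs`, `ShimuraHeegnerEulerSystemSplitPrinted`) — given instead (i) three
further PUBLISHED facts (Kato–Wuthrich surjective divisibility, SW Thm. 6.1 SPLIT, the split canonical
§4.2 height), (ii) the exceptional display `ClassClosure.RelativeExceptionalLeadingTermAt W 3` on the
SPLIT pairs of X11b@3 ∩ `Surj`, and (iii) rung I1 at `3`: the split Schneider half on split `Surj` pairs
and the non-split half on non-split ¬(ram) `Surj` pairs (per pair ONE REGMULT row each).**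

Status of (ii) (memo `HOME/mult-p4/EXZ-ROAD-MEMO-g3.md` §2–§4): on every pair with a SECOND
multiplicative prime (all (ram) pairs) the display is Disegni 2020 Thm. 4 (second bullet, exact form)
read at `p = 3`, every brick of whose printed proof is located in print at `3` modulo two verification
ticks (AUDIT-PENDING; EVIDENCE X11-REPORT v3 150∕150); on `3`-only pairs it is in print up to `ℚ^×`
only. No Skinner–Urban ∕ Skinner 2016 statement is used on roads (b)/(d) beyond those already inside the
class record (`thmA_charIdeal_multiplicative` enters only road (a), as in `closes`).

## Results (namespace `…Theorems.ExceptionalZeroRoad`)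

§1 `multiplicativeRankOneAtThree_of_cruxes_of_conjecture_of_schneider` — the leaf from the four cruxes
+ `PublishedInputsThree` BY NAME + (i)–(iii). §2 `…_of_closesBinders_…` — the same over the binders of
`closes` (`LZZWaldspurgerHeegner`, `IMCDivTwoLociAtThreeR`, `TateSenVanishingAtThree`,
`BDPWaldspurgerSquare` in place of `HalvesAtThreeR` ∕ `HsiehDescentAtThree`, exactly as `closes` derives
them). §3 `…_of_regulatorNonvanishing` — bundled: rung I1 at `3` on X11b@3 ∩ `Surj`
(`ClassClosure.RegulatorNonvanishingAt W 3`) replaces `SchneiderAtThree` and both halves of (iii). §4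
`kolyvaginRoadThree_…_of_closesBinders_…` — the `KolyvaginRoadThree` twin over the binders of ITS `closes`
(the Kolyvagin road on A1 `ZhangSharpFrameAtThreeHL`, `SchneiderTamAtThree`, `IMCDivTwoLociTamAtThreeR`, …).

## Reading (numbers of record, TARGET §2; nothing moves)

On the 961 TRUE-OPEN split ∧ (ram) B10 classes the route's per-pair residual by this road is
{H3 at `3` (crux 20262, inside `HalvesAtThreeR`), the descent (Waldspurger kernel: PUB), H2 (LZZ: PUB),
the display (AUDIT-PENDING), ONE split REGMULT row (960∕961 CERT)} — the Euler crux 19109 (XL) and the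
Tamagawa shapes drop out. CONDITIONAL; closes nothing; the registered line `birth` of 19109 is untouched.

References: [Wuthrich2014] Thm. 3, Cor. 19; [SteinWuthrich2013] Thm. 6.1, §4.2; [Disegni2020] Thm. 1 =
Thm. 4; [MazurTateTeitelbaum1986Invent] §II.10; [Kato2004Asterisque] Thm. 17.4; [Miller2011LMS] Def. 1.1;
cell files HOME/mult-p4/EXZ-ROAD-MEMO-g0…g3.md.
-/

set_option autoImplicit false

-- Theorems files of this problem live in `Summit.BirchSwinnertonDyer.BirchSwinnertonDyer.Theorems.*`.
set_option linter.dupNamespace false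

noncomputable section

open scoped Classical MatrixGroups ModularForm

open CongruenceSubgroup WeierstrassCurve Literature.NumberTheory.EllipticCurves
  Literature.NumberTheory.EllipticCurves.ModularForms
  Literature.NumberTheory.EllipticCurves.Rank1Residual
  Literature.NumberTheory.EllipticCurves.Rank1Residual.Typed
  Literature.NumberTheory.EllipticCurves.SteinWuthrich2013
  Literature.NumberTheory.EllipticCurves.Wuthrich2014

namespace Summit.BirchSwinnertonDyer.BirchSwinnertonDyer.Theorems.ExceptionalZeroRoad

open Summit.BirchSwinnertonDyer.Rank1Residual Summit.BirchSwinnertonDyer.Rank1Residual.X11b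
  Summit.BirchSwinnertonDyer.Rank1Residual.X11b.Three
  Summit.BirchSwinnertonDyer.BirchSwinnertonDyer.Theses.ClassRecordThree

/-! ### §1 The leaf from the route's cruxes by name, crux 5 and the Shimura package replaced -/

/-- **Rung-K2@3 leaf from `SchneiderAtThree` + `HalvesAtThreeR` + `HsiehDescentAtThree` +
`CornerAtThree` + `PublishedInputsThree` and the exceptional-zero road's inputs** — three further
PUBLISHED facts (`hKato` Kato–Wuthrich surjective divisibility, `hJs` SW Thm. 6.1 split, `hHs` the split
canonical height), the exceptional display on split X11b@3 ∩ `Surj` pairs (`hC`, AUDIT-PENDING with a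
second multiplicative prime, `ℚ^×`-grade on `3`-only pairs), the split Schneider half on split `Surj`
pairs (`hSchS`) and the non-split half on non-split ¬(ram) `Surj` pairs (`hSchN`) — WITHOUT crux 5
`EulerHalvesAtThree` and WITHOUT the Shimura-curve inputs of the pure-β sub-atom: every
`Typed.MissingUpperBoundAt W 3` binder of the kernel class record
`multiplicativeRankOneAtThree_of_classRecord_upperB` (`hUβ`, `hUα`, `hUγ`, `hU₀`) is fed by the shape-free
pair theorems of p545447. CONDITIONAL on every binder; nothing booked.
[cite: Wuthrich2014, Thm. 3 (p. 383), Cor. 19] [cite: SteinWuthrich2013, Thm. 6.1, §4.2]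
[cite: Disegni2020, Thm. 1 (§1.2) = Thm. 4 (§3.2)] [cite: MazurTateTeitelbaum1986Invent, §II.10]
[cite: Miller2011LMS, Def. 1.1] -/
theorem multiplicativeRankOneAtThree_of_cruxes_of_conjecture_of_schneider
    (h₁ : SchneiderAtThree) (h₂ : HalvesAtThreeR) (h₃ : HsiehDescentAtThree) (h₅ : CornerAtThree)
    (h₆ : PublishedInputsThree)
    -- (i) the exz road's three further PUBLISHED facts
    (hKato : kato_charIdeal_dvd_multiplicative_of_surjective) (hJs : thm61_splitMultiplicative)
    (hHs : exists_isSplitMultCanonical)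
    -- (ii) the exceptional display on the split pairs of X11b@3 ∩ Surj
    (hC : ∀ (W : WeierstrassCurve ℚ) [W.IsElliptic] [W.IsGloballyMinimal], ClassX11b W 3 → Surj W 3 →
      W.HasSplitMultiplicativeReductionAtPrime 3 → ClassClosure.RelativeExceptionalLeadingTermAt W 3)
    -- (iii) rung I1 at 3: the two Schneider halves on their loci
    (hSchS : ∀ (W : WeierstrassCurve ℚ) [W.IsElliptic] [W.IsGloballyMinimal], ClassX11b W 3 → Surj W 3 →
      W.HasSplitMultiplicativeReductionAtPrime 3 → ∀ (Dq : TateParameterData W 3) (Dh : PAdicHeightData W 3),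
        IsSplitMultCanonical Dh Dq → SchneiderConjecture Dh)
    (hSchN : ∀ (W : WeierstrassCurve ℚ) [W.IsElliptic] [W.IsGloballyMinimal], ClassX11b W 3 → ¬ Ram W 3 →
      Surj W 3 → ¬ W.HasSplitMultiplicativeReductionAtPrime 3 →
        ∀ (q : ℚ_[3]) (Dh : PAdicHeightData W 3), q ≠ 0 → ‖q‖ < 1 → tateJ q = (W.j : ℚ_[3]) →
          IsMultCanonical Dh q → SchneiderConjecture Dh) :
    MultiplicativeRankOneAtThree := by
  obtain ⟨hGZ, hKo, hB, hSk, hWu, hGZK, hmod, hnf, hHL, hMaz, hPT, -, -, hSkA, hJn, hHn, hD, hpar, hMN,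
    hH⟩ := h₆
  -- the Euler half on every SPLIT X11b@3 ∩ Surj pair (shape-free, Tamagawa-blind)
  have hsp : ∀ (W : WeierstrassCurve ℚ) [W.IsElliptic] [W.IsGloballyMinimal], ClassX11b W 3 → Surj W 3 →
      W.HasSplitMultiplicativeReductionAtPrime 3 → Typed.MissingUpperBoundAt W 3 :=
    fun W _ _ hX hsurj hsplit ↦
      Three.missingUpperBoundAt_of_surj_split_of_conjecture_of_schneiderSplit W hKato hJs hHs hGZK hpar hX
        hsurj hsplit (hC W hX hsurj hsplit) (hSchS W hX hsurj hsplit)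
  exact multiplicativeRankOneAtThree_of_classRecord_upperB hGZ hKo hB hSk hWu hGZK hmod hnf hHL hMaz hPT
    hSkA hJn hHn hD hpar hMN hH h₁
    (fun W _ _ hX ↦ (h₃ W hX).1) (fun W _ _ hX ↦ (h₃ W hX).2)
    (fun W _ _ hX ↦ (h₂ W hX).1) (fun W _ _ hX ↦ (h₂ W hX).2)
    (fun W _ _ hX hram hsplit _ _ _ ↦ hsp W hX (surj_of_irr_of_ram W 3 hX.2.2.2 hram) hsplit)
    (fun W _ _ hX hram hα ↦ hsp W hX (surj_of_irr_of_ram W 3 hX.2.2.2 hram) hα.1)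
    (fun W _ _ hX hram hsplit _ _ ↦ hsp W hX (surj_of_irr_of_ram W 3 hX.2.2.2 hram) hsplit)
    (fun W _ _ hX hsurj hnr ↦ by
      by_cases hsplit : W.HasSplitMultiplicativeReductionAtPrime 3
      · exact hsp W hX hsurj hsplit
      · exact Three.missingUpperBoundAt_of_surj_nonsplit_of_schneiderNonsplit W hKato hJn hHn hD hGZK
          hpar hX hsurj hsplit (hSchN W hX hnr hsurj hsplit))
    (fun W _ _ ↦ (h₅ W).1) (fun W _ _ ↦ (h₅ W).2.1) (fun W _ _ ↦ (h₅ W).2.2)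

/-! ### §2 The same over the binders of the deciding theorem `closes` -/

/-- **Over the binders of `Theses.ClassRecordThree.closes` (rev 29)**: `HalvesAtThreeR` and
`HsiehDescentAtThree` are derived exactly as `closes` derives them — the BDP value formula at `3` from
Liu–Zhang–Zhang (`LZZKernel.bdpValueAt₃_of_thm151_thm153`), H3 from `IMCDivTwoLociAtThreeR` (crux
20262), the descent from BDP's Waldspurger formula + Tate–Sen
(`WaldspurgerKernel.hsiehDescentAt₃_of_thm54_of_tateSen`); the six binders `h₄` (crux 19109) and
`hJL`, `hRT`, `hOff`, `hCT3`, `hESs` (Shimura package) of `closes` are replaced by (i)–(iii) of §1.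
CONDITIONAL; nothing booked. [cite: LiuZhangZhang2018, Thm. 1.5.1, Thm. 1.5.3]
[cite: BertoliniDarmonPrasanna2013, Thm. 5.4] [cite: Wuthrich2014, Thm. 3, Cor. 19]
[cite: SteinWuthrich2013, Thm. 6.1, §4.2] [cite: Disegni2020, Thm. 1 (§1.2)] -/
theorem multiplicativeRankOneAtThree_of_closesBinders_of_conjecture_of_schneider
    (h₁ : SchneiderAtThree) (hLZZ : LZZWaldspurgerHeegner) (h3R : IMCDivTwoLociAtThreeR)
    (hTS : TateSenVanishingAtThree) (hW : BDPWaldspurgerSquare) (h₅ : CornerAtThree)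
    (h₆ : PublishedInputsThree)
    (hKato : kato_charIdeal_dvd_multiplicative_of_surjective) (hJs : thm61_splitMultiplicative)
    (hHs : exists_isSplitMultCanonical)
    (hC : ∀ (W : WeierstrassCurve ℚ) [W.IsElliptic] [W.IsGloballyMinimal], ClassX11b W 3 → Surj W 3 →
      W.HasSplitMultiplicativeReductionAtPrime 3 → ClassClosure.RelativeExceptionalLeadingTermAt W 3)
    (hSchS : ∀ (W : WeierstrassCurve ℚ) [W.IsElliptic] [W.IsGloballyMinimal], ClassX11b W 3 → Surj W 3 →
      W.HasSplitMultiplicativeReductionAtPrime 3 → ∀ (Dq : TateParameterData W 3) (Dh : PAdicHeightData W 3),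
        IsSplitMultCanonical Dh Dq → SchneiderConjecture Dh)
    (hSchN : ∀ (W : WeierstrassCurve ℚ) [W.IsElliptic] [W.IsGloballyMinimal], ClassX11b W 3 → ¬ Ram W 3 →
      Surj W 3 → ¬ W.HasSplitMultiplicativeReductionAtPrime 3 →
        ∀ (q : ℚ_[3]) (Dh : PAdicHeightData W 3), q ≠ 0 → ‖q‖ < 1 → tateJ q = (W.j : ℚ_[3]) →
          IsMultCanonical Dh q → SchneiderConjecture Dh) :
    MultiplicativeRankOneAtThree := by
  have h₃ : HsiehDescentAtThree :=
    Summit.BirchSwinnertonDyer.BirchSwinnertonDyer.Theorems.WaldspurgerKernel.hsiehDescentAt₃_of_thm54_of_tateSen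
      hW hTS
  have hV :=
    Summit.BirchSwinnertonDyer.BirchSwinnertonDyer.Theorems.LZZKernel.bdpValueAt₃_of_thm151_thm153 hLZZ
  have h₂ : HalvesAtThreeR := fun W _ _ hX ↦
    ⟨fun hram hsp ↦ ⟨hV W, (h3R W hX).1 hram hsp⟩, fun hnr hsurj ↦ ⟨hV W, (h3R W hX).2 hnr hsurj⟩⟩
  exact multiplicativeRankOneAtThree_of_cruxes_of_conjecture_of_schneider h₁ h₂ h₃ h₅ h₆ hKato hJs hHs hC
    hSchS hSchN

/-! ### §3 Bundled form: rung I1 at `3` on X11b@3 ∩ Surj -/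

/-- **Bundled form**: rung I1 at `3` on the whole of X11b@3 ∩ `Surj`
(`ClassClosure.RegulatorNonvanishingAt W 3`, both Schneider halves; `Surj W 3` is automatic on (ram) by
`surj_of_irr_of_ram`, so this CONTAINS crux `SchneiderAtThree`) + the display on the split pairs +
`HalvesAtThreeR` + `HsiehDescentAtThree` + `CornerAtThree` + `PublishedInputsThree` + the three further
PUBLISHED facts ⟹ the leaf. CONDITIONAL; nothing booked. [cite: Wuthrich2014, Thm. 3, Cor. 19]
[cite: SteinWuthrich2013, Thm. 6.1, §4.2, Conj. 4.1] [cite: Disegni2020, Thm. 1 (§1.2)]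
[cite: Schneider1982PadicHeightI, §1] -/
theorem multiplicativeRankOneAtThree_of_cruxes_of_conjecture_of_regulatorNonvanishing
    (h₂ : HalvesAtThreeR) (h₃ : HsiehDescentAtThree) (h₅ : CornerAtThree) (h₆ : PublishedInputsThree)
    (hKato : kato_charIdeal_dvd_multiplicative_of_surjective) (hJs : thm61_splitMultiplicative)
    (hHs : exists_isSplitMultCanonical)
    (hC : ∀ (W : WeierstrassCurve ℚ) [W.IsElliptic] [W.IsGloballyMinimal], ClassX11b W 3 → Surj W 3 →
      W.HasSplitMultiplicativeReductionAtPrime 3 → ClassClosure.RelativeExceptionalLeadingTermAt W 3)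
    (hReg : ∀ (W : WeierstrassCurve ℚ) [W.IsElliptic] [W.IsGloballyMinimal], ClassX11b W 3 → Surj W 3 →
      ClassClosure.RegulatorNonvanishingAt W 3) :
    MultiplicativeRankOneAtThree :=
  multiplicativeRankOneAtThree_of_cruxes_of_conjecture_of_schneider
    (fun W _ _ hX hram _ ↦ hReg W hX (surj_of_irr_of_ram W 3 hX.2.2.2 hram)) h₂ h₃ h₅ h₆ hKato hJs hHs hC
    (fun W _ _ hX hsurj _ ↦ (hReg W hX hsurj).2) (fun W _ _ hX _ hsurj _ ↦ (hReg W hX hsurj).1)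

/-! ### §4 The `KolyvaginRoadThree` twin over the binders of its deciding theorem -/

/-- **Route `KolyvaginRoadThree` (same leaf), over the binders of ITS `closes` (rev of 2026-08-27)**:
`ZhangSharpFrameAtThreeHL` (the Kolyvagin road on A1), `SchneiderTamAtThree`, `LZZWaldspurgerHeegner`,
`IMCDivTwoLociTamAtThreeR`, `TateSenVanishingAtThree`, `BDPWaldspurgerSquare`, `CornerAtThree`,
`PublishedInputsKolyThree` — with its crux `EulerHalvesAtThree` (the 19109 twin) AND its five Shimura
supports REPLACED by the exz road's inputs (i)–(iii) of §1; the kernel record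
`multiplicativeRankOneAtThree_of_kolyRecord_upperB` is fed exactly as that `closes` feeds it, except
that `hUβ`, `hUα`, `hUγ`, `hU₀` come from p545447's shape-free pair theorems. CONDITIONAL; nothing
booked. [cite: Wuthrich2014, Thm. 3, Cor. 19] [cite: SteinWuthrich2013, Thm. 6.1, §4.2]
[cite: Disegni2020, Thm. 1 (§1.2)] [cite: LiuZhangZhang2018, Thm. 1.5.1, Thm. 1.5.3]
[cite: BertoliniDarmonPrasanna2013, Thm. 5.4] -/
theorem kolyvaginRoadThree_multiplicativeRankOneAtThree_of_closesBinders_of_conjecture_of_schneider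
    (h₁ : Summit.BirchSwinnertonDyer.BirchSwinnertonDyer.Theses.KolyvaginRoadThree.ZhangSharpFrameAtThreeHL)
    (h₂ : Summit.BirchSwinnertonDyer.BirchSwinnertonDyer.Theses.KolyvaginRoadThree.SchneiderTamAtThree)
    (hLZZ : Summit.BirchSwinnertonDyer.BirchSwinnertonDyer.Theses.KolyvaginRoadThree.LZZWaldspurgerHeegner)
    (h3R : Summit.BirchSwinnertonDyer.BirchSwinnertonDyer.Theses.KolyvaginRoadThree.IMCDivTwoLociTamAtThreeR)
    (hTS : Summit.BirchSwinnertonDyer.BirchSwinnertonDyer.Theses.KolyvaginRoadThree.TateSenVanishingAtThree)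
    (hW : Summit.BirchSwinnertonDyer.BirchSwinnertonDyer.Theses.KolyvaginRoadThree.BDPWaldspurgerSquare)
    (h₆ : Summit.BirchSwinnertonDyer.BirchSwinnertonDyer.Theses.KolyvaginRoadThree.CornerAtThree)
    (h₇ : Summit.BirchSwinnertonDyer.BirchSwinnertonDyer.Theses.KolyvaginRoadThree.PublishedInputsKolyThree)
    (hKato : kato_charIdeal_dvd_multiplicative_of_surjective) (hJs : thm61_splitMultiplicative)
    (hHs : exists_isSplitMultCanonical)
    (hC : ∀ (W : WeierstrassCurve ℚ) [W.IsElliptic] [W.IsGloballyMinimal], ClassX11b W 3 → Surj W 3 →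
      W.HasSplitMultiplicativeReductionAtPrime 3 → ClassClosure.RelativeExceptionalLeadingTermAt W 3)
    (hSchS : ∀ (W : WeierstrassCurve ℚ) [W.IsElliptic] [W.IsGloballyMinimal], ClassX11b W 3 → Surj W 3 →
      W.HasSplitMultiplicativeReductionAtPrime 3 → ∀ (Dq : TateParameterData W 3) (Dh : PAdicHeightData W 3),
        IsSplitMultCanonical Dh Dq → SchneiderConjecture Dh)
    (hSchN : ∀ (W : WeierstrassCurve ℚ) [W.IsElliptic] [W.IsGloballyMinimal], ClassX11b W 3 → ¬ Ram W 3 →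
      Surj W 3 → ¬ W.HasSplitMultiplicativeReductionAtPrime 3 →
        ∀ (q : ℚ_[3]) (Dh : PAdicHeightData W 3), q ≠ 0 → ‖q‖ < 1 → tateJ q = (W.j : ℚ_[3]) →
          IsMultCanonical Dh q → SchneiderConjecture Dh) :
    MultiplicativeRankOneAtThree := by
  have h₄ : Summit.BirchSwinnertonDyer.BirchSwinnertonDyer.Theses.KolyvaginRoadThree.HsiehDescentAtThree :=
    Summit.BirchSwinnertonDyer.BirchSwinnertonDyer.Theorems.WaldspurgerKernel.hsiehDescentAt₃_of_thm54_of_tateSen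
      hW hTS
  have hV :=
    Summit.BirchSwinnertonDyer.BirchSwinnertonDyer.Theorems.LZZKernel.bdpValueAt₃_of_thm151_thm153 hLZZ
  have h₃ : Summit.BirchSwinnertonDyer.BirchSwinnertonDyer.Theses.KolyvaginRoadThree.HalvesTamAtThreeR :=
    fun W _ _ hX ↦
      ⟨fun hram hsp htam ↦ ⟨hV W, (h3R W hX).1 hram hsp htam⟩, fun hnr hsurj ↦ ⟨hV W, (h3R W hX).2 hnr hsurj⟩⟩
  obtain ⟨⟨hGZ, hKo, hB, hSk, hWu, hGZK, hmod, hnf, hHL, hMaz, hPT, -, -, hSkA, hJn, hHn, hD, hpar, hMN, hH⟩,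
    hMc, hrec, hKD⟩ := h₇
  -- the Euler half on every SPLIT X11b@3 ∩ Surj pair (shape-free, Tamagawa-blind)
  have hsp : ∀ (W : WeierstrassCurve ℚ) [W.IsElliptic] [W.IsGloballyMinimal], ClassX11b W 3 → Surj W 3 →
      W.HasSplitMultiplicativeReductionAtPrime 3 → Typed.MissingUpperBoundAt W 3 :=
    fun W _ _ hX hsurj hsplit ↦
      Three.missingUpperBoundAt_of_surj_split_of_conjecture_of_schneiderSplit W hKato hJs hHs hGZK hpar hX
        hsurj hsplit (hC W hX hsurj hsplit) (hSchS W hX hsurj hsplit)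
  exact multiplicativeRankOneAtThree_of_kolyRecord_upperB hGZ hKo hB hSk hWu hGZK hmod hnf hHL hMaz hPT
    hSkA hJn hHn hD hpar hMN hH
    (fun W _ _ hX hram htam ↦
      Koly.bsdp_three_onA1_of_kolyvaginFramesHL hGZ hKo hB hSk hGZK hmod hnf hHL hMaz hrec hMc hKD h₁ W hX
        hram htam)
    h₂ (fun W _ _ hX ↦ (h₄ W hX).1) (fun W _ _ hX ↦ (h₃ W hX).1)
    (fun W _ _ hX hram hsplit _ _ _ ↦ hsp W hX (surj_of_irr_of_ram W 3 hX.2.2.2 hram) hsplit)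
    (fun W _ _ hX hram hα ↦ hsp W hX (surj_of_irr_of_ram W 3 hX.2.2.2 hram) hα.1)
    (fun W _ _ hX hram hsplit _ _ ↦ hsp W hX (surj_of_irr_of_ram W 3 hX.2.2.2 hram) hsplit)
    (fun W _ _ hX ↦ (h₄ W hX).2) (fun W _ _ hX ↦ (h₃ W hX).2)
    (fun W _ _ hX hsurj hnr ↦ by
      by_cases hsplit : W.HasSplitMultiplicativeReductionAtPrime 3
      · exact hsp W hX hsurj hsplit
      · exact Three.missingUpperBoundAt_of_surj_nonsplit_of_schneiderNonsplit W hKato hJn hHn hD hGZK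
          hpar hX hsurj hsplit (hSchN W hX hnr hsurj hsplit))
    (fun W _ _ ↦ (h₆ W).1) (fun W _ _ ↦ (h₆ W).2.1) (fun W _ _ ↦ (h₆ W).2.2)

end Summit.BirchSwinnertonDyer.BirchSwinnertonDyer.Theorems.ExceptionalZeroRoad

end
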